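import Mathlib

/-!
# Stub `stub_ffrCircle` — planar angular pigeonhole (crux `GappedShellCensus.FiveFoldRationingR`, line `Sketch`)

Nonzero vectors of `ℝ³` orthogonal to a fixed `b ≠ 0` lie in the plane `bᗮ`; if their pairwise
angles are `≥ arccos (41/100) ≈ 65.8°` then (A) there are at most five of them, and (B) four of them
are never all at angle `≥ arccos (1/8)` from a fixed nonzero `e ⊥ b`.

The proof is trigonometry-free.  An orthonormal frame of `bᗮ` (`ffrCircle_frame`) turns everything
into real arithmetic on planar coordinates `(x, y)` with `r² = x² + y²`.  The relevant angular region is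
covered by closed sectors `cone(d, d')` spanned by explicit directions with `cos ∠(d, d') > 41/100`;
two vectors in a common sector have cosine `> 41/100` (`ffrCircle_cone`, a Lagrange-identity
computation), so the pigeonhole principle (five vectors in four sectors, resp. four vectors in three
sectors) contradicts the separation hypothesis.
-/

namespace Summit.AtomisticToContinuum.Crystallization.Theorems

/-- **Same sector ⇒ small angle.** If `q = (x, y)` and `q' = (x', y')` both lie in the closed convex
sector spanned by the directions `d = (d1, d2)` and `d' = (e1, e2)` (oriented, less than `180°` apart),
and `cos ∠(d, d') > 41/100` (stated rationally), then `cos ∠(q, q') > 41/100`. -/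
private theorem ffrCircle_cone {d1 d2 e1 e2 x y r x' y' r' : ℝ}
    (hC : 0 < d1 * e2 - d2 * e1) (hP : 0 < d1 * e1 + d2 * e2)
    (hP2 : 1681 / 10000 * ((d1 ^ 2 + d2 ^ 2) * (e1 ^ 2 + e2 ^ 2)) < (d1 * e1 + d2 * e2) ^ 2)
    (hr : 0 < r) (hrr : r ^ 2 = x ^ 2 + y ^ 2) (hr' : 0 < r') (hrr' : r' ^ 2 = x' ^ 2 + y' ^ 2)
    (h1 : 0 ≤ d1 * y - d2 * x) (h2 : 0 ≤ x * e2 - y * e1)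
    (h1' : 0 ≤ d1 * y' - d2 * x') (h2' : 0 ≤ x' * e2 - y' * e1) :
    41 / 100 * (r * r') < x * x' + y * y' := by
  obtain ⟨C, hCd⟩ : ∃ C, C = d1 * e2 - d2 * e1 := ⟨_, rfl⟩
  obtain ⟨P, hPd⟩ : ∃ P, P = d1 * e1 + d2 * e2 := ⟨_, rfl⟩
  obtain ⟨T, hTd⟩ : ∃ T, T = x * x' + y * y' := ⟨_, rfl⟩
  obtain ⟨S, hSd⟩ : ∃ S, S = x * y' - y * x' := ⟨_, rfl⟩
  obtain ⟨D, hDd⟩ : ∃ D, D = (d1 ^ 2 + d2 ^ 2) * (e1 ^ 2 + e2 ^ 2) := ⟨_, rfl⟩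
  rw [← hCd] at hC
  rw [← hPd] at hP
  rw [← hPd, ← hDd] at hP2
  rw [← hTd]
  -- polynomial identities
  have i1 : C ^ 2 * T = (x * e2 - y * e1) * (x' * e2 - y' * e1) * (d1 ^ 2 + d2 ^ 2)
      + (d1 * y - d2 * x) * (d1 * y' - d2 * x') * (e1 ^ 2 + e2 ^ 2)
      + ((x * e2 - y * e1) * (d1 * y' - d2 * x') + (d1 * y - d2 * x) * (x' * e2 - y' * e1)) * P := by
    rw [hCd, hTd, hPd]; ring
  have i2 : C * S =
      (x * e2 - y * e1) * (d1 * y' - d2 * x') - (d1 * y - d2 * x) * (x' * e2 - y' * e1) := by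
    rw [hCd, hSd]; ring
  have i3 : C ^ 2 + P ^ 2 = D := by rw [hCd, hPd, hDd]; ring
  have i4 : r ^ 2 * r' ^ 2 = T ^ 2 + S ^ 2 := by rw [hrr, hrr', hTd, hSd]; ring
  -- `C² T ≥ (A B' + B A') P`
  have s1 : ((x * e2 - y * e1) * (d1 * y' - d2 * x') + (d1 * y - d2 * x) * (x' * e2 - y' * e1)) * P
      ≤ C ^ 2 * T := by
    rw [i1]
    have t1 : 0 ≤ (x * e2 - y * e1) * (x' * e2 - y' * e1) * (d1 ^ 2 + d2 ^ 2) :=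
      mul_nonneg (mul_nonneg h2 h2') (by positivity)
    have t2 : 0 ≤ (d1 * y - d2 * x) * (d1 * y' - d2 * x') * (e1 ^ 2 + e2 ^ 2) :=
      mul_nonneg (mul_nonneg h1 h1') (by positivity)
    linarith
  -- `C T ≥ |P S|`
  have s2a : P * S ≤ C * T := by
    have h0 : 0 ≤ C * (C * T - P * S) := by
      have e : C * (C * T - P * S) = C ^ 2 * T - P * (C * S) := by ring
      rw [e, i2]
      linarith [mul_nonneg (mul_nonneg h1 h2') hP.le]
    refine not_lt.mp fun hcon => ?_
    linarith [mul_pos hC (sub_pos.mpr hcon)]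
  have s2b : -(P * S) ≤ C * T := by
    have h0 : 0 ≤ C * (C * T + P * S) := by
      have e : C * (C * T + P * S) = C ^ 2 * T + P * (C * S) := by ring
      rw [e, i2]
      linarith [mul_nonneg (mul_nonneg h2 h1') hP.le]
    refine not_lt.mp fun hcon => ?_
    linarith [mul_pos hC (show 0 < -(P * S) - C * T by linarith)]
  have hT : 0 ≤ T := by
    refine not_lt.mp fun hcon => ?_
    linarith [mul_pos hC (neg_pos.mpr hcon)]
  -- square and use the Lagrange identities
  have s4 : P ^ 2 * S ^ 2 ≤ C ^ 2 * T ^ 2 := by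
    have := mul_nonneg (sub_nonneg.mpr s2a) (show 0 ≤ C * T + P * S by linarith)
    linarith [this]
  have s5 : P ^ 2 * (r ^ 2 * r' ^ 2) ≤ T ^ 2 * D := by
    rw [i4, ← i3]; linarith [s4]
  have hD : 0 < D := by rw [← i3]; positivity
  have hRR : 0 < r ^ 2 * r' ^ 2 := by positivity
  have s6 : 1681 / 10000 * (r ^ 2 * r' ^ 2) < T ^ 2 := by
    refine not_le.mp fun hcon => ?_
    have a1 := mul_lt_mul_of_pos_right hP2 hRR
    have a2 := mul_le_mul_of_nonneg_right hcon hD.le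
    linarith [a1, a2, s5]
  refine not_le.mp fun hcon => ?_
  linarith [mul_le_mul hcon hcon hT (by positivity), s6]

/-- Rotation of planar coordinates: the frame `(a, b)/c`, `(-b, a)/c` with `c² = a² + b²` is
orthonormal, so inner products are unchanged. -/
private theorem ffrCircle_rot {a b c : ℝ} (hc : 0 < c) (habc : c ^ 2 = a ^ 2 + b ^ 2)
    (x y x' y' : ℝ) :
    (x * a + y * b) / c * ((x' * a + y' * b) / c) + (y * a - x * b) / c * ((y' * a - x' * b) / c)
      = x * x' + y * y' := by
  rw [div_mul_div_comm, div_mul_div_comm, ← add_div, div_eq_iff (by positivity)]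
  linear_combination (x * x' + y * y') * habc.symm

/-! ### Part (A): five vectors outside the `65.8°` cone about `+x` -/

/-- A planar vector with `x ≤ 0.41 r` satisfies `15 x ≤ 8 |y|` (here `t = |y|`). -/
private theorem ffrCircle_keyA {x y r t : ℝ} (hr : 0 < r) (hrr : r ^ 2 = x ^ 2 + y ^ 2)
    (hx : x ≤ 41 / 100 * r) (ht : 0 ≤ t) (hty : t ^ 2 = y ^ 2) : 15 * x ≤ 8 * t := by
  rcases le_or_gt x 0 with hx0 | hx0
  · linarith
  · have h1 : x * x ≤ (41 / 100 * r) * (41 / 100 * r) := mul_le_mul hx hx hx0.le (by positivity)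
    have h2 : 225 * x ^ 2 ≤ 64 * t ^ 2 := by linarith [sq_nonneg t]
    refine not_lt.mp fun hcon => ?_
    linarith [mul_self_lt_mul_self (by positivity : (0:ℝ) ≤ 8 * t) hcon]

/-- Coverage (A): a nonzero planar vector with `x ≤ 0.41 r` lies in one of the four closed sectors
`cone(dₖ, dₖ₊₁)`, `d = (8,15), (-8,13), (-1,0), (-8,-13), (8,-15)`. -/
private theorem ffrCircle_coverA {x y r : ℝ} (hr : 0 < r) (hrr : r ^ 2 = x ^ 2 + y ^ 2)
    (hx : x ≤ 41 / 100 * r) :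
    ∃ k : Fin 4, 0 ≤ (![8, -8, -1, -8] : Fin 4 → ℝ) k * y - (![15, 13, 0, -13] : Fin 4 → ℝ) k * x ∧
      0 ≤ x * (![13, 0, -13, -15] : Fin 4 → ℝ) k - y * (![-8, -1, -8, 8] : Fin 4 → ℝ) k := by
  rcases le_or_gt 0 y with hy | hy
  · have key := ffrCircle_keyA hr hrr hx hy rfl
    rcases le_or_gt (13 * x + 8 * y) 0 with h | h
    · exact ⟨1, by simp; linarith, by simp; linarith⟩
    · exact ⟨0, by simp; linarith, by simp; linarith⟩
  · have key := ffrCircle_keyA hr hrr hx (neg_nonneg.mpr hy.le) (by ring : (-y) ^ 2 = y ^ 2)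
    rcases le_or_gt (13 * x - 8 * y) 0 with h | h
    · exact ⟨2, by simp; linarith, by simp; linarith⟩
    · exact ⟨3, by simp; linarith, by simp; linarith⟩

/-- Sector data (A): consecutive directions are less than `180°` apart and at angle with cosine
`> 41/100`. -/
private theorem ffrCircle_tabA (k : Fin 4) :
    0 < (![8, -8, -1, -8] : Fin 4 → ℝ) k * (![13, 0, -13, -15] : Fin 4 → ℝ) k -
        (![15, 13, 0, -13] : Fin 4 → ℝ) k * (![-8, -1, -8, 8] : Fin 4 → ℝ) k ∧
    0 < (![8, -8, -1, -8] : Fin 4 → ℝ) k * (![-8, -1, -8, 8] : Fin 4 → ℝ) k +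
        (![15, 13, 0, -13] : Fin 4 → ℝ) k * (![13, 0, -13, -15] : Fin 4 → ℝ) k ∧
    1681 / 10000 * (((![8, -8, -1, -8] : Fin 4 → ℝ) k ^ 2 + (![15, 13, 0, -13] : Fin 4 → ℝ) k ^ 2) *
        ((![-8, -1, -8, 8] : Fin 4 → ℝ) k ^ 2 + (![13, 0, -13, -15] : Fin 4 → ℝ) k ^ 2)) <
      ((![8, -8, -1, -8] : Fin 4 → ℝ) k * (![-8, -1, -8, 8] : Fin 4 → ℝ) k +
        (![15, 13, 0, -13] : Fin 4 → ℝ) k * (![13, 0, -13, -15] : Fin 4 → ℝ) k) ^ 2 := by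
  fin_cases k <;> simp <;> norm_num

/-- Five planar vectors with `x ≤ 0.41 r` cannot be pairwise at cosine `≤ 41/100`
(pigeonhole over the four sectors of `ffrCircle_coverA`). -/
private theorem ffrCircle_fiveA (x y r : Fin 5 → ℝ) (hr : ∀ i, 0 < r i)
    (hrr : ∀ i, r i ^ 2 = x i ^ 2 + y i ^ 2) (hx : ∀ i, x i ≤ 41 / 100 * r i)
    (hsep : ∀ i j, i ≠ j → x i * x j + y i * y j ≤ 41 / 100 * (r i * r j)) : False := by
  choose f hf using fun i => ffrCircle_coverA (hr i) (hrr i) (hx i)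
  obtain ⟨i, j, hij, hfij⟩ := Fintype.exists_ne_map_eq_of_card_lt f (by simp)
  obtain ⟨hC, hP, hP2⟩ := ffrCircle_tabA (f i)
  obtain ⟨h1, h2⟩ := hf i
  obtain ⟨h1', h2'⟩ := hf j
  rw [← hfij] at h1' h2'
  exact absurd (hsep i j hij)
    (not_le.mpr (ffrCircle_cone hC hP hP2 (hr i) (hrr i) (hr j) (hrr j) h1 h2 h1' h2'))

/-- **(A) in coordinates.** Six nonzero planar vectors cannot be pairwise at cosine `≤ 41/100`:
rotate the first one to `+x`; the other five then have `x ≤ 0.41 r`. -/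
private theorem ffrCircle_sixA (x y r : Fin 6 → ℝ) (hr : ∀ i, 0 < r i)
    (hrr : ∀ i, r i ^ 2 = x i ^ 2 + y i ^ 2)
    (hsep : ∀ i j, i ≠ j → x i * x j + y i * y j ≤ 41 / 100 * (r i * r j)) : False := by
  have hXY : ∀ i j, (x i * x 0 + y i * y 0) / r 0 * ((x j * x 0 + y j * y 0) / r 0) +
      (y i * x 0 - x i * y 0) / r 0 * ((y j * x 0 - x j * y 0) / r 0) = x i * x j + y i * y j :=
    fun i j => ffrCircle_rot (hr 0) (hrr 0) _ _ _ _
  have hX0 : (x 0 * x 0 + y 0 * y 0) / r 0 = r 0 := by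
    rw [div_eq_iff (hr 0).ne']; linarith [hrr 0]
  have hY0 : (y 0 * x 0 - x 0 * y 0) / r 0 = 0 := by rw [mul_comm, sub_self, zero_div]
  have hrr' : ∀ i : Fin 5, r i.succ ^ 2 = ((x i.succ * x 0 + y i.succ * y 0) / r 0) ^ 2 +
      ((y i.succ * x 0 - x i.succ * y 0) / r 0) ^ 2 := by
    intro i
    rw [hrr]; linarith [hXY i.succ i.succ]
  have hx' : ∀ i : Fin 5, (x i.succ * x 0 + y i.succ * y 0) / r 0 ≤ 41 / 100 * r i.succ := by
    intro i
    have h1 := hsep i.succ 0 (Fin.succ_ne_zero i)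
    have h2 := hXY i.succ 0
    rw [hX0, hY0, mul_zero, add_zero] at h2
    have h3 : (x i.succ * x 0 + y i.succ * y 0) / r 0 * r 0 ≤ 41 / 100 * r i.succ * r 0 := by
      rw [h2]; linarith
    exact le_of_mul_le_mul_right h3 (hr 0)
  have hsep' : ∀ i j : Fin 5, i ≠ j →
      (x i.succ * x 0 + y i.succ * y 0) / r 0 * ((x j.succ * x 0 + y j.succ * y 0) / r 0) +
      (y i.succ * x 0 - x i.succ * y 0) / r 0 * ((y j.succ * x 0 - x j.succ * y 0) / r 0) ≤
        41 / 100 * (r i.succ * r j.succ) := by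
    intro i j hij
    rw [hXY]
    exact hsep _ _ (fun h => hij (Fin.succ_inj.mp h))
  exact ffrCircle_fiveA (fun i => (x i.succ * x 0 + y i.succ * y 0) / r 0)
    (fun i => (y i.succ * x 0 - x i.succ * y 0) / r 0) (fun i => r i.succ) (fun i => hr _)
    hrr' hx' hsep'

/-! ### Part (B): four vectors with `x ≥ -r/8` -/

/-- A planar vector with `x ≥ -r/8` satisfies `3 √7 · x + |y| ≥ 0` (here `t = |y|`). -/
private theorem ffrCircle_keyB {x y r t : ℝ} (hr : 0 < r) (hrr : r ^ 2 = x ^ 2 + y ^ 2)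
    (hx : -r ≤ 8 * x) (ht : 0 ≤ t) (hty : t ^ 2 = y ^ 2) : 0 ≤ 3 * Real.sqrt 7 * x + t := by
  have hs : Real.sqrt 7 * Real.sqrt 7 = 7 := Real.mul_self_sqrt (by norm_num)
  rcases le_or_gt 0 x with hx0 | hx0
  · exact add_nonneg (mul_nonneg (by positivity) hx0) ht
  · have h1 : (-(8 * x)) * (-(8 * x)) ≤ r * r :=
      mul_le_mul (by linarith) (by linarith) (by linarith) hr.le
    have h2 : 63 * x ^ 2 ≤ t ^ 2 := by linarith
    refine not_lt.mp fun hcon => ?_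
    have h3 : t * t < (3 * Real.sqrt 7 * (-x)) * (3 * Real.sqrt 7 * (-x)) :=
      mul_self_lt_mul_self ht (by linarith)
    have h4 : (3 * Real.sqrt 7 * (-x)) * (3 * Real.sqrt 7 * (-x)) = 63 * (x * x) := by
      linear_combination (9 * x * x) * hs
    linarith [h3, h4]

/-- Coverage (B): a nonzero planar vector with `x ≥ -r/8` lies in one of the three closed sectors
`cone(dₖ, dₖ₊₁)`, `d = (-1,-3√7), (8,-5), (8,5), (-1,3√7)`. -/
private theorem ffrCircle_coverB {x y r : ℝ} (hr : 0 < r) (hrr : r ^ 2 = x ^ 2 + y ^ 2)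
    (hx : -r ≤ 8 * x) :
    ∃ k : Fin 3, 0 ≤ (![-1, 8, 8] : Fin 3 → ℝ) k * y - (![-3 * Real.sqrt 7, -5, 5] : Fin 3 → ℝ) k * x ∧
      0 ≤ x * (![-5, 5, 3 * Real.sqrt 7] : Fin 3 → ℝ) k - y * (![8, 8, -1] : Fin 3 → ℝ) k := by
  rcases le_or_gt 0 y with hy | hy
  · have key := ffrCircle_keyB hr hrr hx hy rfl
    rcases le_or_gt (8 * y) (5 * x) with h | h
    · exact ⟨1, by simp; linarith, by simp; linarith⟩
    · exact ⟨2, by simp; linarith, by simp; linarith⟩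
  · have key := ffrCircle_keyB hr hrr hx (neg_nonneg.mpr hy.le) (by ring : (-y) ^ 2 = y ^ 2)
    rcases le_or_gt (8 * y + 5 * x) 0 with h | h
    · exact ⟨0, by simp; linarith, by simp; linarith⟩
    · exact ⟨1, by simp; linarith, by simp; linarith⟩

/-- Sector data (B): consecutive directions are less than `180°` apart and at angle with cosine
`> 41/100` (`39/89 ≈ 0.438` and `(15√7 - 8)/(8√89) ≈ 0.4199`). -/
private theorem ffrCircle_tabB (k : Fin 3) :
    0 < (![-1, 8, 8] : Fin 3 → ℝ) k * (![-5, 5, 3 * Real.sqrt 7] : Fin 3 → ℝ) k -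
        (![-3 * Real.sqrt 7, -5, 5] : Fin 3 → ℝ) k * (![8, 8, -1] : Fin 3 → ℝ) k ∧
    0 < (![-1, 8, 8] : Fin 3 → ℝ) k * (![8, 8, -1] : Fin 3 → ℝ) k +
        (![-3 * Real.sqrt 7, -5, 5] : Fin 3 → ℝ) k * (![-5, 5, 3 * Real.sqrt 7] : Fin 3 → ℝ) k ∧
    1681 / 10000 * (((![-1, 8, 8] : Fin 3 → ℝ) k ^ 2 + (![-3 * Real.sqrt 7, -5, 5] : Fin 3 → ℝ) k ^ 2) *
        ((![8, 8, -1] : Fin 3 → ℝ) k ^ 2 + (![-5, 5, 3 * Real.sqrt 7] : Fin 3 → ℝ) k ^ 2)) <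
      ((![-1, 8, 8] : Fin 3 → ℝ) k * (![8, 8, -1] : Fin 3 → ℝ) k +
        (![-3 * Real.sqrt 7, -5, 5] : Fin 3 → ℝ) k * (![-5, 5, 3 * Real.sqrt 7] : Fin 3 → ℝ) k) ^ 2 := by
  have hs : Real.sqrt 7 ^ 2 = 7 := Real.sq_sqrt (by norm_num)
  have hs1 : (26 / 10 : ℝ) < Real.sqrt 7 := by
    rw [Real.lt_sqrt (by norm_num)]; norm_num
  have hs2 : Real.sqrt 7 < 27 / 10 := by
    rw [Real.sqrt_lt' (by norm_num)]; norm_num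
  fin_cases k <;> refine ⟨?_, ?_, ?_⟩ <;> simp <;> nlinarith [hs, hs1, hs2]

/-- Four planar vectors with `x ≥ -r/8` cannot be pairwise at cosine `≤ 41/100`
(pigeonhole over the three sectors of `ffrCircle_coverB`). -/
private theorem ffrCircle_fourB0 (x y r : Fin 4 → ℝ) (hr : ∀ i, 0 < r i)
    (hrr : ∀ i, r i ^ 2 = x i ^ 2 + y i ^ 2) (hx : ∀ i, -r i ≤ 8 * x i)
    (hsep : ∀ i j, i ≠ j → x i * x j + y i * y j ≤ 41 / 100 * (r i * r j)) : False := by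
  choose f hf using fun i => ffrCircle_coverB (hr i) (hrr i) (hx i)
  obtain ⟨i, j, hij, hfij⟩ := Fintype.exists_ne_map_eq_of_card_lt f (by simp)
  obtain ⟨hC, hP, hP2⟩ := ffrCircle_tabB (f i)
  obtain ⟨h1, h2⟩ := hf i
  obtain ⟨h1', h2'⟩ := hf j
  rw [← hfij] at h1' h2'
  exact absurd (hsep i j hij)
    (not_le.mpr (ffrCircle_cone hC hP hP2 (hr i) (hrr i) (hr j) (hrr j) h1 h2 h1' h2'))

/-- **(B) in coordinates.** Four nonzero planar vectors pairwise at cosine `≤ 41/100` cannot all be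
at cosine `≤ 1/8` from a nonzero direction `(a, b)`: rotate `-(a, b)` to `+x`. -/
private theorem ffrCircle_fourB (x y r : Fin 4 → ℝ) (a b c : ℝ) (hc : 0 < c)
    (habc : c ^ 2 = a ^ 2 + b ^ 2) (hr : ∀ i, 0 < r i)
    (hrr : ∀ i, r i ^ 2 = x i ^ 2 + y i ^ 2)
    (hsep : ∀ i j, i ≠ j → x i * x j + y i * y j ≤ 41 / 100 * (r i * r j))
    (he : ∀ i, x i * a + y i * b ≤ 1 / 8 * (r i * c)) : False := by
  have habc' : c ^ 2 = (-a) ^ 2 + (-b) ^ 2 := by rw [habc]; ring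
  have hXY : ∀ i j, (x i * (-a) + y i * (-b)) / c * ((x j * (-a) + y j * (-b)) / c) +
      (y i * (-a) - x i * (-b)) / c * ((y j * (-a) - x j * (-b)) / c) = x i * x j + y i * y j :=
    fun i j => ffrCircle_rot hc habc' _ _ _ _
  have hrr' : ∀ i, r i ^ 2 =
      ((x i * (-a) + y i * (-b)) / c) ^ 2 + ((y i * (-a) - x i * (-b)) / c) ^ 2 := by
    intro i
    rw [hrr]; linarith [hXY i i]
  have hx' : ∀ i, -r i ≤ 8 * ((x i * (-a) + y i * (-b)) / c) := by
    intro i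
    rw [← mul_div_assoc, le_div_iff₀ hc]
    linarith [he i]
  have hsep' : ∀ i j, i ≠ j →
      (x i * (-a) + y i * (-b)) / c * ((x j * (-a) + y j * (-b)) / c) +
      (y i * (-a) - x i * (-b)) / c * ((y j * (-a) - x j * (-b)) / c) ≤ 41 / 100 * (r i * r j) := by
    intro i j hij
    rw [hXY]
    exact hsep i j hij
  exact ffrCircle_fourB0 (fun i => (x i * (-a) + y i * (-b)) / c)
    (fun i => (y i * (-a) - x i * (-b)) / c) r hr hrr' hx' hsep'

/-! ### From `ℝ³` to the plane `bᗮ` -/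

/-- An orthonormal frame `(f, g)` of the plane `bᗮ ⊆ ℝ³` (`b ≠ 0`): Parseval's identity for vectors
orthogonal to `b`. -/
private theorem ffrCircle_frame (b : EuclideanSpace ℝ (Fin 3)) (hb : b ≠ 0) :
    ∃ f g : EuclideanSpace ℝ (Fin 3), ∀ q q' : EuclideanSpace ℝ (Fin 3),
      inner ℝ q b = 0 → inner ℝ q' b = 0 →
      inner ℝ q q' = inner ℝ q f * inner ℝ q' f + inner ℝ q g * inner ℝ q' g := by
  haveI : Fact (Module.finrank ℝ (EuclideanSpace ℝ (Fin 3)) = 2 + 1) := ⟨by simp⟩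
  have hK : Module.finrank ℝ (ℝ ∙ b)ᗮ = 2 := Submodule.finrank_orthogonal_span_singleton hb
  let ob : OrthonormalBasis (Fin 2) ℝ (ℝ ∙ b)ᗮ :=
    (stdOrthonormalBasis ℝ (ℝ ∙ b)ᗮ).reindex (finCongr hK)
  refine ⟨(ob 0 : EuclideanSpace ℝ (Fin 3)), (ob 1 : EuclideanSpace ℝ (Fin 3)),
    fun q q' hq hq' => ?_⟩
  have hqK : q ∈ (ℝ ∙ b)ᗮ := Submodule.mem_orthogonal_singleton_iff_inner_left.mpr hq
  have hq'K : q' ∈ (ℝ ∙ b)ᗮ := Submodule.mem_orthogonal_singleton_iff_inner_left.mpr hq'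
  have h := ob.sum_inner_mul_inner ⟨q, hqK⟩ ⟨q', hq'K⟩
  rw [Fin.sum_univ_two] at h
  simp only [Submodule.coe_inner] at h
  rw [← h, real_inner_comm q', real_inner_comm q']

/-- **Stub 2 (planar angular pigeonhole).** Nonzero vectors orthogonal to a fixed `b ≠ 0` with
pairwise angles `≥ arccos (41/100) > 65.8°`: (A) there are at most five of them (`6 × 65.8° > 360°`);
(B) four of them never all make an angle `≥ arccos (1/8)` with a fixed direction `e ⊥ b`
(`2 × 97.2° < 3 × 65.8°`). [folklore] -/
theorem stub_ffrCircle :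
    (∀ (b : EuclideanSpace ℝ (Fin 3)), b ≠ 0 → ∀ q : Fin 6 → EuclideanSpace ℝ (Fin 3),
        (∀ i, q i ≠ 0) → (∀ i, inner ℝ (q i) b = 0) →
        (∀ i j, i ≠ j → inner ℝ (q i) (q j) ≤ 41 / 100 * (‖q i‖ * ‖q j‖)) → False) ∧
    (∀ (b : EuclideanSpace ℝ (Fin 3)), b ≠ 0 → ∀ e : EuclideanSpace ℝ (Fin 3), e ≠ 0 →
        inner ℝ e b = 0 → ∀ q : Fin 4 → EuclideanSpace ℝ (Fin 3),
        (∀ i, q i ≠ 0) → (∀ i, inner ℝ (q i) b = 0) →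
        (∀ i j, i ≠ j → inner ℝ (q i) (q j) ≤ 41 / 100 * (‖q i‖ * ‖q j‖)) →
        ∃ i, 1 / 8 * (‖q i‖ * ‖e‖) < inner ℝ (q i) e) := by
  constructor
  · intro b hb q hq hqb hsep
    obtain ⟨f, g, hfg⟩ := ffrCircle_frame b hb
    have hrr : ∀ i, ‖q i‖ ^ 2 = inner ℝ (q i) f ^ 2 + inner ℝ (q i) g ^ 2 := by
      intro i
      rw [← real_inner_self_eq_norm_sq, hfg (q i) (q i) (hqb i) (hqb i)]; ring
    have hsep' : ∀ i j, i ≠ j →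
        inner ℝ (q i) f * inner ℝ (q j) f + inner ℝ (q i) g * inner ℝ (q j) g ≤
          41 / 100 * (‖q i‖ * ‖q j‖) := by
      intro i j hij
      rw [← hfg (q i) (q j) (hqb i) (hqb j)]
      exact hsep i j hij
    exact ffrCircle_sixA (fun i => inner ℝ (q i) f) (fun i => inner ℝ (q i) g) (fun i => ‖q i‖)
      (fun i => norm_pos_iff.mpr (hq i)) hrr hsep'
  · intro b hb e he heb q hq hqb hsep
    obtain ⟨f, g, hfg⟩ := ffrCircle_frame b hb
    by_contra hcon0
    have hcon : ∀ i, inner ℝ (q i) e ≤ 1 / 8 * (‖q i‖ * ‖e‖) :=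
      fun i => not_lt.mp fun h => hcon0 ⟨i, h⟩
    have hrr : ∀ i, ‖q i‖ ^ 2 = inner ℝ (q i) f ^ 2 + inner ℝ (q i) g ^ 2 := by
      intro i
      rw [← real_inner_self_eq_norm_sq, hfg (q i) (q i) (hqb i) (hqb i)]; ring
    have hsep' : ∀ i j, i ≠ j →
        inner ℝ (q i) f * inner ℝ (q j) f + inner ℝ (q i) g * inner ℝ (q j) g ≤
          41 / 100 * (‖q i‖ * ‖q j‖) := by
      intro i j hij
      rw [← hfg (q i) (q j) (hqb i) (hqb j)]
      exact hsep i j hij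
    have hee : ‖e‖ ^ 2 = inner ℝ e f ^ 2 + inner ℝ e g ^ 2 := by
      rw [← real_inner_self_eq_norm_sq, hfg e e heb heb]; ring
    have he' : ∀ i, inner ℝ (q i) f * inner ℝ e f + inner ℝ (q i) g * inner ℝ e g ≤
        1 / 8 * (‖q i‖ * ‖e‖) := by
      intro i
      rw [← hfg (q i) e (hqb i) heb]
      exact hcon i
    exact ffrCircle_fourB (fun i => inner ℝ (q i) f) (fun i => inner ℝ (q i) g) (fun i => ‖q i‖)
      (inner ℝ e f) (inner ℝ e g) ‖e‖ (norm_pos_iff.mpr he) hee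
      (fun i => norm_pos_iff.mpr (hq i)) hrr hsep' he'

end Summit.AtomisticToContinuum.Crystallization.Theorems
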